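import Mathlib
import Literature.Analysis.ODE.RegularSingularAnalyticBranch
import Summits.AtomisticToContinuum.HydrodynamicLimit.Theorems.ImplosionDichotomyDenseExcursionSonicCavityDefs

/-!
# Power series of the coefficients of the characteristic system at the sonic point
# (crux `DenseExcursion`, line `sonic-cavity-renewal`, brick for stub `stub_cavityResolventCk`, theorem T2)

Helper file (`--supports stmt-AtomisticToContinuum-12586`, line lead a2, stub-worker W4 for `stub_cavityResolventCk`).
In the characteristic fields `p = ŵ + 3ŝ`, `q = ŵ − 3ŝ` the resolvent equation `(Λ − L)(ŵ, ŝ) = (f, g)` reads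
`c₊ p′ = (Λ − b₊₊)p − b₊₋ q − (f + 3g)`, `c₋ q′ = −b₋₊ p + (Λ − b₋₋)q − (f − 3g)` (`mode_char_system`) with
`c₊ = W − 1 + S = x·η(x)`, `η = dslope c₊ 0` (sonic point at `0`, `η(0) = W′(0) + S′(0) = −κ`), `c₋ = W − 1 − S < 0`.
Dividing the `p`-row by `η` and multiplying the `q`-row by `x/c₋` gives the first-kind singular system `x v′ = N(x)v + t`
with `N(Λ, x) = Λ·diag(1/η, x/c₋) − [[b₊₊/η, b₊₋/η],[x b₋₊/c₋, x b₋₋/c₋]]`. This file supplies, from `IsMonatomicProfile`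
and `CavityTube` (clause (e): `W`, `S` analytic on `|x| < 1/10` with majorant `10^m`; clause (a): chord bound
`|c₊| ≥ 3|x|/8`; clause (c): `|W| ≤ 1/4`), the SEVEN `Λ`-independent coefficient functions `1/η`, `x/c₋`, `b₊₊/η`,
`b₊₋/η`, `x b₋₊/c₋`, `x b₋₋/c₋`, `1/c₋` as real power series with a COMMON geometric majorant `C θⁿ` on a common
interval `(−ρ₀, ρ₀)`, `ρ₀ ≤ 1`, together with `x η(x) = c₊(x)`, `η ≠ 0`, `c₋ < 0` there and the numerical sonic data
`−7/4 ≤ W′(0) + S′(0) ≤ −2/5`, `|b₊₋(0)| ≤ 3/2` (registered helper `sonic_coefficient_series`). Tools: Mathlib's analytic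
calculus (`AnalyticAt.deriv/.inv/.div`, `HasFPowerSeriesAt.has_fpower_series_dslope_fslope`) and Cauchy-type bounds from
the radius of convergence (`FormalMultilinearSeries.norm_mul_pow_le_of_lt_radius`). Sources: folklore.
-/

noncomputable section

open Set Filter
open scoped Topology ContDiff NNReal ENNReal

namespace Summit.AtomisticToContinuum.HydrodynamicLimit.Theorems.SonicCavityRenewal

open Summit.AtomisticToContinuum.HydrodynamicLimit.Theorems.R2OneModeTwoConditions
open Literature.Analysis.ODE (hasFPowerSeriesOnBall_tsum_pow_smul)

/-- A real function given on `|x| < 1/10` by a power series with majorant `10^m` (CavityTube (e)) is analytic at `0`.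
[folklore] -/
theorem analyticAt_of_tube_series {f : ℝ → ℝ} {a : ℕ → ℝ} (ha : ∀ m, |a m| ≤ 10 ^ m)
    (hf : ∀ x : ℝ, |x| < 1 / 10 → HasSum (fun m => a m * x ^ m) (f x)) : AnalyticAt ℝ f 0 := by
  have hw : ∀ n, ‖a n‖ ≤ 1 * (10 : ℝ) ^ n := fun n => by simpa using ha n
  have h := hasFPowerSeriesOnBall_tsum_pow_smul (𝕜 := ℝ) hw (by norm_num) (r := 10⁻¹) (by norm_num)
    (by rw [NNReal.coe_inv]; norm_num)
  refine (h.congr fun x hx => ?_).analyticAt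
  rw [Metric.eball_coe, Metric.mem_ball, dist_zero_right, Real.norm_eq_abs, NNReal.coe_inv] at hx
  rw [← (hf x (by norm_num at hx ⊢; exact hx)).tsum_eq]
  exact tsum_congr fun n => by rw [smul_eq_mul, mul_comm]

/-- A real function analytic at `0` has a power series `Σ cₙ xⁿ` on some `|x| < ρ` with a geometric majorant
`|cₙ| ≤ C θⁿ`. [folklore] -/
theorem exists_powerSeries_of_analyticAt {f : ℝ → ℝ} (hf : AnalyticAt ℝ f 0) :
    ∃ (c : ℕ → ℝ) (ρ C θ : ℝ), 0 < ρ ∧ 0 ≤ C ∧ 0 < θ ∧ (∀ n, |c n| ≤ C * θ ^ n) ∧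
      ∀ x : ℝ, |x| < ρ → HasSum (fun n => c n * x ^ n) (f x) := by
  obtain ⟨p, r, hp⟩ := hf
  obtain ⟨r', hr'0, hr'r⟩ := ENNReal.lt_iff_exists_nnreal_btwn.1 hp.r_pos
  have hr'0' : (0 : ℝ≥0) < r' := by exact_mod_cast hr'0
  obtain ⟨C, hC0, hC⟩ := p.norm_mul_pow_le_of_lt_radius (hr'r.trans_le hp.r_le)
  have hp' := hp.mono hr'0 hr'r.le
  have hrpos : (0 : ℝ) < r' := hr'0'
  refine ⟨fun n => p.coeff n, r', C, 1 / r', hrpos, hC0.le, by positivity, fun n => ?_, fun x hx => ?_⟩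
  · rw [← Real.norm_eq_abs, ← p.norm_apply_eq_norm_coef, one_div, inv_pow, ← div_eq_mul_inv,
      le_div_iff₀ (pow_pos hrpos n)]
    exact hC n
  · have hx' : x ∈ Metric.eball (0 : ℝ) r' := by
      rw [Metric.eball_coe, Metric.mem_ball, dist_zero_right, Real.norm_eq_abs]; exact hx
    have := hp'.hasSum hx'
    rw [zero_add] at this
    refine this.congr_fun fun n => ?_
    rw [FormalMultilinearSeries.apply_eq_pow_smul_coeff, smul_eq_mul, mul_comm]

/-- Finitely many real functions analytic at `0` have power series with a COMMON majorant `C θⁿ` on a COMMON interval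
`|x| < ρ`. [folklore] -/
theorem exists_common_powerSeries {m : ℕ} (F : Fin (m + 1) → ℝ → ℝ) (hF : ∀ i, AnalyticAt ℝ (F i) 0) :
    ∃ (ρ C θ : ℝ) (c : Fin (m + 1) → ℕ → ℝ), 0 < ρ ∧ 0 ≤ C ∧ 0 < θ ∧ (∀ i n, |c i n| ≤ C * θ ^ n) ∧
      ∀ i, ∀ x : ℝ, |x| < ρ → HasSum (fun n => c i n * x ^ n) (F i x) := by
  choose c ρ C θ hρ hC hθ hc hsum using fun i => exists_powerSeries_of_analyticAt (hF i)
  refine ⟨Finset.univ.inf' Finset.univ_nonempty ρ, ∑ i, C i, ∑ i, θ i, c,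
    (Finset.lt_inf'_iff _).2 fun i _ => hρ i, Finset.sum_nonneg fun i _ => hC i,
    Finset.sum_pos (fun i _ => hθ i) Finset.univ_nonempty, fun i n => ?_, fun i x hx => ?_⟩
  · calc |c i n| ≤ C i * θ i ^ n := hc i n
      _ ≤ (∑ j, C j) * (∑ j, θ j) ^ n :=
        mul_le_mul (Finset.single_le_sum (fun j _ => hC j) (Finset.mem_univ i))
          (pow_le_pow_left₀ (hθ i).le (Finset.single_le_sum (fun j _ => (hθ j).le) (Finset.mem_univ i)) n)
          (pow_nonneg (hθ i).le n) (Finset.sum_nonneg fun j _ => hC j)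
  · exact hsum i x (hx.trans_le (Finset.inf'_le _ (Finset.mem_univ i)))

/-- **Registered helper `sonic_coefficient_series`: THE COEFFICIENTS OF THE CHARACTERISTIC SYSTEM AT THE SONIC POINT AS
POWER SERIES WITH A COMMON MAJORANT.** For a monatomic profile with a cavity tube: an interval `(−ρ₀, ρ₀)`, `ρ₀ ≤ 1`, on
which `x·η(x) = W − 1 + S` with `η = dslope (W − 1 + S) 0 ≠ 0`, `η(0) = W′(0) + S′(0) ∈ [−7/4, −2/5]`, `W − 1 − S < 0`,
`|b₊₋(0)| ≤ 3/2`, and real sequences `e₀, …, e₆` with `|eᵢₙ| ≤ C θⁿ` summing on `(−ρ₀, ρ₀)` to `1/η`, `x/c₋`, `b₊₊/η`,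
`b₊₋/η`, `x b₋₊/c₋`, `x b₋₋/c₋`, `1/c₋` (`c₋ = W − 1 − S`; `b`'s of `mode_char_system`). [folklore] -/
theorem sonic_coefficient_series : ∀ (r : ℝ) (W S : ℝ → ℝ), IsMonatomicProfile r W S → CavityTube r W S → ∃ ρ₀ : ℝ, 0 < ρ₀ ∧ ρ₀ ≤ 1 ∧ (∀ x : ℝ, x * dslope (fun y => W y - 1 + S y) 0 x = W x - 1 + S x) ∧ dslope (fun y => W y - 1 + S y) 0 0 = deriv W 0 + deriv S 0 ∧ deriv W 0 + deriv S 0 ≤ -(2 / 5) ∧ -(7 / 4) ≤ deriv W 0 + deriv S 0 ∧ |deriv W 0 / 3 + deriv S 0 + 2 * S 0| ≤ 3 / 2 ∧ (∀ x ∈ Set.Ioo (-ρ₀) ρ₀, dslope (fun y => W y - 1 + S y) 0 x ≠ 0 ∧ W x - 1 - S x < 0) ∧ ∃ (C θ : ℝ) (e : Fin 7 → ℕ → ℝ), 0 ≤ C ∧ 0 < θ ∧ (∀ i n, |e i n| ≤ C * θ ^ n) ∧ ∀ x ∈ Set.Ioo (-ρ₀) ρ₀, HasSum (fun n => e 0 n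 * x ^ n) (1 / dslope (fun y => W y - 1 + S y) 0 x) ∧ HasSum (fun n => e 1 n * x ^ n) (x / (W x - 1 - S x)) ∧ HasSum (fun n => e 2 n * x ^ n) ((2 / 3 * deriv W x + 2 * W x - r + 2 * deriv S x + 4 * S x) / dslope (fun y => W y - 1 + S y) 0 x) ∧ HasSum (fun n => e 3 n * x ^ n) ((deriv W x / 3 + deriv S x + 2 * S x) / dslope (fun y => W y - 1 + S y) 0 x) ∧ HasSum (fun n => e 4 n * x ^ n) (x * (deriv W x / 3 - deriv S x - 2 * S x) / (W x - 1 - S x)) ∧ HasSum (fun n => e 5 n * x ^ n) (x * (2 / 3 * deriv W x + 2 * W x - r - 2 * deriv S x - 4 * S x) / (W x - 1 - S x)) ∧ HasSum (fun n => e 6 n * x ^ n) (1 / (W x - 1 - S x)) := by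
  intro r W S hP hT
  obtain ⟨-, -, hW, hS, hSpos, -, -, -, -⟩ := hP
  obtain ⟨h0, -, -, hchord, hκ, -, -, hWc, hSc, -, ⟨a, b, hab, hsum⟩⟩ := hT
  have hW1 : Differentiable ℝ W := hW.differentiable (by simp)
  have hS1 : Differentiable ℝ S := hS.differentiable (by simp)
  -- numerical sonic data from the tube at `x = 0`
  obtain ⟨-, hW', -⟩ := hWc 0 zero_le_one
  obtain ⟨hs₁, hs₂, hs', -⟩ := hSc 0 zero_le_one
  have hds : deriv (fun y => Real.exp y * S y) 0 = S 0 + deriv S 0 := by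
    have h : HasDerivAt (fun y => Real.exp y * S y) (Real.exp 0 * S 0 + Real.exp 0 * deriv S 0) 0 :=
      (Real.hasDerivAt_exp 0).mul (hS1 0).hasDerivAt
    rw [h.deriv]; simp
  rw [hds] at hs'
  rw [Real.exp_zero, one_mul] at hs₁ hs₂
  have hκ' : -(7 / 4) ≤ deriv W 0 + deriv S 0 := by
    linarith [(abs_le.1 hW').1, (abs_le.1 hs').1]
  have hbpm : |deriv W 0 / 3 + deriv S 0 + 2 * S 0| ≤ 3 / 2 := by
    obtain ⟨hW₁, hW₂⟩ := abs_le.1 hW'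
    obtain ⟨hs₃, hs₄⟩ := abs_le.1 hs'
    exact abs_le.2 ⟨by linarith, by linarith⟩
  -- the sonic function `c₊ = W − 1 + S` and `η = dslope c₊ 0`
  set cp : ℝ → ℝ := fun y => W y - 1 + S y with hcp_def
  have hcp0 : cp 0 = 0 := by simp [hcp_def]; linarith
  have hcpd : HasDerivAt cp (deriv W 0 + deriv S 0) 0 := ((hW1 0).hasDerivAt.sub_const 1).add (hS1 0).hasDerivAt
  have hη0 : dslope cp 0 0 = deriv W 0 + deriv S 0 := by rw [dslope_same]; exact hcpd.deriv
  have hxη : ∀ x : ℝ, x * dslope cp 0 x = cp x := fun x => by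
    have := sub_smul_dslope cp 0 x; rwa [sub_zero, hcp0, sub_zero, smul_eq_mul] at this
  -- analyticity at `0` of the ingredients
  have hWa : AnalyticAt ℝ W 0 := analyticAt_of_tube_series (fun m => (hab m).1) fun x hx => (hsum x hx).1
  have hSa : AnalyticAt ℝ S 0 := analyticAt_of_tube_series (fun m => (hab m).2) fun x hx => (hsum x hx).2
  have hWa' : AnalyticAt ℝ (deriv W) 0 := hWa.deriv
  have hSa' : AnalyticAt ℝ (deriv S) 0 := hSa.deriv
  have hcpa : AnalyticAt ℝ cp 0 := (hWa.sub analyticAt_const).add hSa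
  have hηa : AnalyticAt ℝ (dslope cp 0) 0 := by
    obtain ⟨p, hp⟩ := hcpa; exact ⟨_, hp.has_fpower_series_dslope_fslope⟩
  have hηne : dslope cp 0 0 ≠ 0 := by rw [hη0]; linarith
  have hcma : AnalyticAt ℝ (fun y => W y - 1 - S y) 0 := (hWa.sub analyticAt_const).sub hSa
  have hcmne : (fun y => W y - 1 - S y) 0 ≠ 0 := by simp only; linarith [hSpos 0]
  have hbppa : AnalyticAt ℝ (fun y => 2 / 3 * deriv W y + 2 * W y - r + 2 * deriv S y + 4 * S y) 0 :=
    ((((analyticAt_const.mul hWa').add (analyticAt_const.mul hWa)).sub analyticAt_const).add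
      (analyticAt_const.mul hSa')).add (analyticAt_const.mul hSa)
  have hbpma : AnalyticAt ℝ (fun y => deriv W y / 3 + deriv S y + 2 * S y) 0 :=
    ((hWa'.div analyticAt_const (by norm_num)).add hSa').add (analyticAt_const.mul hSa)
  have hbmpa : AnalyticAt ℝ (fun y => deriv W y / 3 - deriv S y - 2 * S y) 0 :=
    ((hWa'.div analyticAt_const (by norm_num)).sub hSa').sub (analyticAt_const.mul hSa)
  have hbmma : AnalyticAt ℝ (fun y => 2 / 3 * deriv W y + 2 * W y - r - 2 * deriv S y - 4 * S y) 0 :=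
    ((((analyticAt_const.mul hWa').add (analyticAt_const.mul hWa)).sub analyticAt_const).sub
      (analyticAt_const.mul hSa')).sub (analyticAt_const.mul hSa)
  -- the seven coefficient functions
  set F : Fin 7 → ℝ → ℝ := ![fun x => 1 / dslope cp 0 x, fun x => x / (W x - 1 - S x),
    fun x => (2 / 3 * deriv W x + 2 * W x - r + 2 * deriv S x + 4 * S x) / dslope cp 0 x,
    fun x => (deriv W x / 3 + deriv S x + 2 * S x) / dslope cp 0 x,
    fun x => x * (deriv W x / 3 - deriv S x - 2 * S x) / (W x - 1 - S x),
    fun x => x * (2 / 3 * deriv W x + 2 * W x - r - 2 * deriv S x - 4 * S x) / (W x - 1 - S x),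
    fun x => 1 / (W x - 1 - S x)] with hF_def
  have hFa : ∀ i, AnalyticAt ℝ (F i) 0 := by
    intro i
    fin_cases i
    · exact analyticAt_const.div hηa hηne
    · exact analyticAt_id.div hcma hcmne
    · exact hbppa.div hηa hηne
    · exact hbpma.div hηa hηne
    · exact (analyticAt_id.mul hbmpa).div hcma hcmne
    · exact (analyticAt_id.mul hbmma).div hcma hcmne
    · exact analyticAt_const.div hcma hcmne
  obtain ⟨ρ, C, θ, e, hρ, hC, hθ, he, hes⟩ := exists_common_powerSeries F hFa
  -- the interval: `ρ₀ = min ρ 1`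
  refine ⟨min ρ 1, lt_min hρ one_pos, min_le_right _ _, hxη, hη0, hκ, hκ', hbpm, fun x hx => ?_,
    C, θ, e, hC, hθ, he, fun x hx => ?_⟩
  · have hx1 : |x| < 1 := (abs_lt.2 hx).trans_le (min_le_right _ _)
    have hxle : x ≤ 1 := le_of_lt (abs_lt.1 hx1).2
    refine ⟨fun hη => ?_, ?_⟩
    · rcases eq_or_ne x 0 with rfl | hx0
      · exact hηne hη
      · have h1 := hchord x hxle
        have h2 : W x + S x - 1 = 0 := by
          have := hxη x
          rw [hη, mul_zero] at this
          simp only [hcp_def] at this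
          linarith
        rw [min_eq_left hx1.le, h2, abs_zero] at h1
        linarith [abs_pos.2 hx0]
    · have := (abs_le.1 (hWc x hxle).1).2
      linarith [hSpos x]
  · have hx' : |x| < ρ := (abs_lt.2 hx).trans_le (min_le_left _ _)
    exact ⟨hes 0 x hx', hes 1 x hx', hes 2 x hx', hes 3 x hx', hes 4 x hx', hes 5 x hx', hes 6 x hx'⟩

end Summit.AtomisticToContinuum.HydrodynamicLimit.Theorems.SonicCavityRenewal

end
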